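/-
Copyright: the b2b-balaban T⁴-continuum CRUX team, row NE7b leaf lineage `t4-ne7b-formalise-leaf-06` (gen 157). Project licence.
-/
import Summits.QuantumFields.BalabanUV.T4Continuum.Spine.NE7b.AugmentedHessianEquivalence
import Summits.QuantumFields.BalabanUV.T4Continuum.Spine.NE7b.TransportedHessianEnergyCeiling

/-!
# THE CHART LETTER THROUGH A TEST SECTION: the augmented Hessian's inverse has
# `‖T⁻¹(k, φ)‖ ≤ (‖S‖ + √(C∕m))‖k‖ + m⁻¹‖φ‖`, hence `‖T⁻¹‖ ≤ ‖S‖ + √(C∕m) + m⁻¹`, for ANY section `S` of the blocking with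
# energy `V″(Sk)(Sk) ≤ C‖k‖²` — the chart constant `N` of `…HardStepChartRadius` from the ACTUAL inverse's two columns (the
# critical section and the Green's function on `ker D`) instead of `…AugmentedHessianEquivalence`'s global `(1 + ‖V″‖∕m)‖M‖ + m⁻¹`;
# the condition number enters under a square root and through the test section's energy (row NE7b, node U5c; [folklore] —
# Pythagoras for a form + Lax–Milgram, two landed siblings BY NAME)

Cell `pub-balaban`, sub-cell `t4`, spine estimate NE7b (`T4WeightBudget.RelWeightBound`; the cell's OWN estimate — NOT PRINTED in
[Bałaban 1983–89], NOT PROVED).  Crux-route work under `Spine/NE7b/` by a row leaf (`t4-ne7b-formalise-leaf-06` gen 157) in the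
hard-step cell under FREEZE (0)'s crux-prover clause; NOTHING of Bałaban's is named as a Lean object, valued or asserted; no
`T4Continuum/Support` leaf typed; no `def`; zero `sorry`.  Imports, BY NAME and nothing restated: leaf-03's `…AugmentedHessianEquivalence`
(AHE §3 `exists_augHessian_equiv` — the equivalence EXISTS; §4 `fst_aug_symm` ∕ `aug_symm_inl_orthogonal` — the `(k, 0)` column is a
`Q`-orthogonal section; `norm_symm_inr_le` — the `(0, φ)` column has norm `≤ m⁻¹‖φ‖`) and this lineage's `…TransportedHessianEnergyCeiling`
(THEC §1c `norm_branch_apply_le_of_testSection` ∕ `opNorm_branch_le_of_testSection` — a `Q`-orthogonal section is bounded through ANY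
test section's energy).  AHE's own NOT-HERE names the object («symmetric-`Q` refinements … sharper constants hold»); the pricing desk
located it as the road's debt (α) ([NE7bREF-G97-LOCUS2-WORD]: «a chart constant from the actual inverse's ∕ Green's function letters
instead of AHE's global `N`»; F699: the one-shot chart letter as typed is the condition number).

WHY.  Every letter of the hard-step chart (`…HardStepChartRadius` ∕ `…HardStepInductiveStep`: radius `(N⁻¹ − c)·r`, Lipschitz and
derivative bound `K₁ = (N⁻¹ − c)⁻¹`, smallness `c < N⁻¹`, the moduli `K₁³M₃`, …) is driven by the ONE displayed constant `N` with
`‖T⁻¹ y‖ ≤ N‖y‖`.  AHE supplies `N = (1 + ‖Q‖∕m)‖M‖ + m⁻¹` from kernel coercivity alone — the condition number `‖Q‖∕m` times the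
crude section's norm; in coercivity units on a non-trivial blocking this forces `K₁ ≥ N ≥ (1 + B∕m)‖M‖ + 1`, which is what empties
the uniform closing boxes (`…HardStepUnitBox` §6).  But `T⁻¹` has two columns: `T⁻¹(k, 0)` is the `Q`-ORTHOGONAL section of `D` (the
derivative of the critical branch at the centre — QFM's propagator), and `T⁻¹(0, φ)` is the Lax–Milgram solve on `ker D`.  For a
symmetric nonnegative `Q` (a convex window) the first column has the LEAST energy among sections, so THEC bounds it through the
energy `C` of any explicit test section `S`: `‖T⁻¹(k,0)‖ ≤ (‖S‖ + √(C∕m))‖k‖`; the second column is `≤ m⁻¹‖φ‖` regardless.  Hence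
`N_S := ‖S‖ + √(C∕m) + m⁻¹` serves as HSCR's `N` — `‖Q‖` never enters, and the coercivity enters under a square root.  Taking the crude
test section `S := M` with the crude energy `C := ‖Q‖‖M‖²` recovers a constant never worse than AHE's as soon as `m ≤ ‖Q‖` (which
holds whenever `ker D ≠ 0`), so nothing is lost (§4).  CONSUMERS (by shape, not imported): leaf-04's `…HardStepBranchDerivSharp`
(HSBDS §2 `norm_fderiv_sliceBranch_le_sharp`: along HSCR's chart `‖σ′(w)‖ ≤ (1 − Nc)⁻¹·‖T⁻¹ ∘ inl‖` — §1 below supplies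
`‖T⁻¹ ∘ inl‖ ≤ ‖S‖ + √(C∕m)`, so the branch-derivative constant is `K₁♯ = (1 − Nc)⁻¹(‖S‖ + √(C∕m))` and the Green's-function column
`m⁻¹` enters it only through the Neumann product `Nc`; HSBDS §3 `sharpChart_le_of_testSection` is that arithmetic), leaf-03's
`…PropagatorPerturbation` (PPT: the coercivity route `‖σ′(w)‖ ≤ (m∕(m − c))‖T₀‖`, no `N` — complementary; `N` stays in HSCR's radius,
which is where §3 below acts).

WHAT IS PROVED ([folklore]; `E` a real inner-product space (complete in §3), `F` real normed, `Q : E →L E →L ℝ` SYMMETRIC and `≥ 0`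
on `E`, `D : E →L F`, a section `S : F →L E` (`D(Sk) = k`), kernel coercivity `m‖κ‖² ≤ Qκκ` on `ker D` (`0 < m`), the energy
letter `Q(Sk)(Sk) ≤ C‖k‖²` (`0 ≤ C`); `T : E ≃L F × (ker D →L ℝ)` any equivalence reading the augmented Hessian,
`T h = (D h, (Q h).comp (ker D).subtypeL)` — AHE's `hT` VERBATIM):
* §1 THE `(k, 0)` COLUMN THROUGH A TEST SECTION: `symm_inl_section` (`D(T⁻¹(k,0)) = k`, AHE), **`norm_symm_inl_le_of_testSection`**
  (`‖T⁻¹(k,0)‖ ≤ ‖Sk‖ + √(Q(Sk)(Sk)∕m)` — THEC §1c at the column, AHE's orthogonality letter), **`opNorm_symm_inl_le_of_testSection`**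
  (`‖T⁻¹ ∘ inl‖ ≤ ‖S‖ + √(C∕m)`), `norm_symm_inl_le_of_testSection'` (`‖T⁻¹(k,0)‖ ≤ (‖S‖ + √(C∕m))‖k‖`).
* §2 THE WHOLE INVERSE: **`norm_symm_le_of_testSection_columns`** (`‖T⁻¹ y‖ ≤ (‖S‖ + √(C∕m))‖y.1‖ + m⁻¹‖y.2‖`),
  **`norm_symm_le_of_testSection`** (`‖T⁻¹ y‖ ≤ (‖S‖ + √(C∕m) + m⁻¹)‖y‖`, sup norm on the product).
* §3 THE END IN `…HardStepChartRadius`'s BINDER SHAPE: **`exists_augHessian_equiv_of_testSection`** (`E` complete ⟹ `∃ T`, `hT`, and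
  `∀ y, ‖T⁻¹ y‖ ≤ (‖S‖ + √(C∕m) + m⁻¹)‖y‖`), **`exists_augHessian_equiv_of_testSection_nnreal`** (the same for ANY `N : ℝ≥0` with
  `‖S‖ + √(C∕m) + m⁻¹ ≤ N` — `exists_criticalBranch_chart_ker`'s `T`, `hT`, `hN` verbatim; HSIS's `inductiveStep` runs on it unchanged
  with this `hN` in place of AHE's).
* §3b FROM A SANDWICH (the energy currency): `sqrt_mul_sq_div`, **`exists_augHessian_equiv_of_sandwich`** (`γ₀‖v‖² ≤ Qvv ≤ γ₁‖v‖²`,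
  `‖S‖ ≤ s` ⟹ constant `s + s√(γ₁∕γ₀) + γ₀⁻¹`), **`exists_augHessian_equiv_energyCurrency`** (isometric section — `F` in the quotient norm
  of `D`: constant `1 + √(γ₁∕γ₀) + γ₀⁻¹`, the sandwich constants and nothing else; for a COMPOSITE blocking in its own quotient norm this
  is the one-shot chart letter, uniform in the number of steps).
* §4 NOTHING IS LOST: `energy_le_of_rightInverse` (the crude energy letter `Q(Mk)(Mk) ≤ ‖Q‖‖M‖²‖k‖²` of any section),
  `coercivity_le_opNorm` (`m ≤ ‖Q‖` once `ker D ∋ κ ≠ 0`), `sqrt_le_of_one_le` (`1 ≤ x ⟹ 1 + √x ≤ 1 + x` in the shape used),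
  **`testSection_const_le_AHE_const`** (`m ≤ ‖Q‖ ⟹ ‖M‖ + √(‖Q‖‖M‖²∕m) + m⁻¹ ≤ (1 + ‖Q‖∕m)‖M‖ + m⁻¹`).
* §5 toy.

NOT HERE (honest): the test sections and their energies BY VALUE for print's blockings (block-constant ∕ smooth interpolants on
`L`-blocks — leaf-01's TSPB ∕ FFTI letters; the pricing desk's instruments F698 ∕ F699 value them; (A3) ∕ (A1c), NC-NE7b-α UNRULED);
indefinite `Q` (only the convex window `Q ≥ 0` on `E`); the smallness letter `c < N⁻¹` (separate); anything of Bałaban's.  BY-NAME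
EFFECT ON THE WALL: NONE.  NE7b NOT PRINTED ∕ NOT PROVED; spine PROVED 0∕9; rung (B)+1 on a FINITE torus — NOT infinite volume, NOT
the mass gap, NOT Clay.  HONEST DEPENDENCY: continuum YM on T⁴ ⇐ BetaPertH ∧ nine spine estimates (0∕9 proved); BetaPertH ⇐ (D1) ∧
(D4) ∧ CAP+tail; G-an2-4 gates asym, D1 and NE2∕3∕4.
-/

set_option autoImplicit false

noncomputable section

namespace Summit.QuantumFields.BalabanUV.T4Continuum.NE7b.ChartLetterTestSection

open scoped NNReal
open Summit.QuantumFields.BalabanUV.T4Continuum.NE7b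

variable {E F : Type*} [NormedAddCommGroup E] [InnerProductSpace ℝ E] [NormedAddCommGroup F] [NormedSpace ℝ F]
variable {Q : E →L[ℝ] E →L[ℝ] ℝ} {D : E →L[ℝ] F}

/-! ## §1. The `(k, 0)` column of `T⁻¹` through a test section -/

/-- The `(k, 0)` column of `T⁻¹`, read as the continuous linear map `T⁻¹ ∘ inl`, evaluates to `T⁻¹ (k, 0)`. [folklore] -/
theorem symm_inl_apply (T : E ≃L[ℝ] F × (D.ker →L[ℝ] ℝ)) (k : F) :
    ((T.symm : F × (D.ker →L[ℝ] ℝ) →L[ℝ] E).comp (ContinuousLinearMap.inl ℝ F (D.ker →L[ℝ] ℝ))) k = T.symm (k, 0) := rfl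

/-- The `(k, 0)` column is a SECTION of `D`: `D (T⁻¹ (k, 0)) = k` (AHE `fst_aug_symm`). [folklore] -/
theorem symm_inl_section (T : E ≃L[ℝ] F × (D.ker →L[ℝ] ℝ)) (hT : ∀ h, T h = (D h, (Q h).comp D.ker.subtypeL)) (k : F) :
    D (((T.symm : F × (D.ker →L[ℝ] ℝ) →L[ℝ] E).comp (ContinuousLinearMap.inl ℝ F (D.ker →L[ℝ] ℝ))) k) = k := by
  rw [symm_inl_apply]; exact AugmentedHessianEquivalence.fst_aug_symm T hT (k, 0)

/-- **THE `(k, 0)` COLUMN THROUGH A TEST SECTION, POINTWISE**: `Q` symmetric and `≥ 0`, `m`-coercive on `ker D`, `S` any section ⟹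
`‖T⁻¹ (k, 0)‖ ≤ ‖S k‖ + √(Q(Sk)(Sk) ∕ m)` — THEC `norm_branch_apply_le_of_testSection` at the column, whose two letters (`D ∘ column = 1`,
`Q`-orthogonality to `ker D`) are AHE's `fst_aug_symm` ∕ `aug_symm_inl_orthogonal`. [folklore] -/
theorem norm_symm_inl_le_of_testSection (T : E ≃L[ℝ] F × (D.ker →L[ℝ] ℝ))
    (hT : ∀ h, T h = (D h, (Q h).comp D.ker.subtypeL)) (S : F →L[ℝ] E) (hS : ∀ k, D (S k) = k)
    (hsymm : ∀ u v, Q u v = Q v u) (hQ0 : ∀ v, 0 ≤ Q v v) {m : ℝ} (hm : 0 < m)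
    (hco : ∀ κ, D κ = 0 → m * ‖κ‖ ^ 2 ≤ Q κ κ) (k : F) :
    ‖T.symm (k, 0)‖ ≤ ‖S k‖ + Real.sqrt (Q (S k) (S k) / m) := by
  have h := TransportedHessianEnergyCeiling.norm_branch_apply_le_of_testSection Q D
    ((T.symm : F × (D.ker →L[ℝ] ℝ) →L[ℝ] E).comp (ContinuousLinearMap.inl ℝ F (D.ker →L[ℝ] ℝ))) S
    (symm_inl_section T hT) hS
    (fun k' κ hκ => by rw [symm_inl_apply]; exact AugmentedHessianEquivalence.aug_symm_inl_orthogonal T hT k' κ hκ)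
    hsymm hQ0 hm hco k
  rwa [symm_inl_apply] at h

/-- **THE `(k, 0)` COLUMN THROUGH A TEST SECTION, IN OPERATOR NORM**: with the energy letter `Q(Sk)(Sk) ≤ C‖k‖²` (`0 ≤ C`),
`‖T⁻¹ ∘ inl‖ ≤ ‖S‖ + √(C∕m)` (THEC `opNorm_branch_le_of_testSection` at the column). [folklore] -/
theorem opNorm_symm_inl_le_of_testSection (T : E ≃L[ℝ] F × (D.ker →L[ℝ] ℝ))
    (hT : ∀ h, T h = (D h, (Q h).comp D.ker.subtypeL)) (S : F →L[ℝ] E) (hS : ∀ k, D (S k) = k)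
    (hsymm : ∀ u v, Q u v = Q v u) (hQ0 : ∀ v, 0 ≤ Q v v) {m : ℝ} (hm : 0 < m)
    (hco : ∀ κ, D κ = 0 → m * ‖κ‖ ^ 2 ≤ Q κ κ) {C : ℝ} (hC0 : 0 ≤ C) (hC : ∀ k, Q (S k) (S k) ≤ C * ‖k‖ ^ 2) :
    ‖(T.symm : F × (D.ker →L[ℝ] ℝ) →L[ℝ] E).comp (ContinuousLinearMap.inl ℝ F (D.ker →L[ℝ] ℝ))‖ ≤ ‖S‖ + Real.sqrt (C / m) :=
  TransportedHessianEnergyCeiling.opNorm_branch_le_of_testSection Q D _ S (symm_inl_section T hT) hS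
    (fun k' κ hκ => by rw [symm_inl_apply]; exact AugmentedHessianEquivalence.aug_symm_inl_orthogonal T hT k' κ hκ)
    hsymm hQ0 hm hco hC0 hC

/-- The pointwise form with the energy constant: `‖T⁻¹ (k, 0)‖ ≤ (‖S‖ + √(C∕m))‖k‖`. [folklore] -/
theorem norm_symm_inl_le_of_testSection' (T : E ≃L[ℝ] F × (D.ker →L[ℝ] ℝ))
    (hT : ∀ h, T h = (D h, (Q h).comp D.ker.subtypeL)) (S : F →L[ℝ] E) (hS : ∀ k, D (S k) = k)
    (hsymm : ∀ u v, Q u v = Q v u) (hQ0 : ∀ v, 0 ≤ Q v v) {m : ℝ} (hm : 0 < m)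
    (hco : ∀ κ, D κ = 0 → m * ‖κ‖ ^ 2 ≤ Q κ κ) {C : ℝ} (hC0 : 0 ≤ C) (hC : ∀ k, Q (S k) (S k) ≤ C * ‖k‖ ^ 2) (k : F) :
    ‖T.symm (k, 0)‖ ≤ (‖S‖ + Real.sqrt (C / m)) * ‖k‖ := by
  rw [← symm_inl_apply T k]
  exact (ContinuousLinearMap.le_opNorm _ k).trans
    (mul_le_mul_of_nonneg_right (opNorm_symm_inl_le_of_testSection T hT S hS hsymm hQ0 hm hco hC0 hC) (norm_nonneg k))

/-! ## §2. The whole inverse: the two columns added -/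

/-- **THE INVERSE THROUGH A TEST SECTION, COLUMN BY COLUMN**: `‖T⁻¹ y‖ ≤ (‖S‖ + √(C∕m))‖y.1‖ + m⁻¹‖y.2‖` — §1 for the `(k, 0)`
column, AHE `norm_symm_inr_le` (Lax–Milgram on `ker D`) for the `(0, φ)` column. [folklore] -/
theorem norm_symm_le_of_testSection_columns (T : E ≃L[ℝ] F × (D.ker →L[ℝ] ℝ))
    (hT : ∀ h, T h = (D h, (Q h).comp D.ker.subtypeL)) (S : F →L[ℝ] E) (hS : ∀ k, D (S k) = k)
    (hsymm : ∀ u v, Q u v = Q v u) (hQ0 : ∀ v, 0 ≤ Q v v) {m : ℝ} (hm : 0 < m)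
    (hco : ∀ κ, D κ = 0 → m * ‖κ‖ ^ 2 ≤ Q κ κ) {C : ℝ} (hC0 : 0 ≤ C) (hC : ∀ k, Q (S k) (S k) ≤ C * ‖k‖ ^ 2)
    (y : F × (D.ker →L[ℝ] ℝ)) :
    ‖T.symm y‖ ≤ (‖S‖ + Real.sqrt (C / m)) * ‖y.1‖ + m⁻¹ * ‖y.2‖ := by
  have e : T.symm y = T.symm (y.1, 0) + T.symm (0, y.2) := by
    rw [← map_add, Prod.mk_add_mk, add_zero, zero_add]
  rw [e]
  exact (norm_add_le _ _).trans (add_le_add (norm_symm_inl_le_of_testSection' T hT S hS hsymm hQ0 hm hco hC0 hC y.1)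
    (AugmentedHessianEquivalence.norm_symm_inr_le hS hm hco T hT y.2))

/-- **THE CHART LETTER THROUGH A TEST SECTION**: `‖T⁻¹ y‖ ≤ (‖S‖ + √(C∕m) + m⁻¹)‖y‖` in the sup norm on `F × (ker D →L ℝ)` — the
constant `…HardStepChartRadius` calls `N`, with `‖Q‖` absent and the coercivity under a square root. [folklore] -/
theorem norm_symm_le_of_testSection (T : E ≃L[ℝ] F × (D.ker →L[ℝ] ℝ))
    (hT : ∀ h, T h = (D h, (Q h).comp D.ker.subtypeL)) (S : F →L[ℝ] E) (hS : ∀ k, D (S k) = k)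
    (hsymm : ∀ u v, Q u v = Q v u) (hQ0 : ∀ v, 0 ≤ Q v v) {m : ℝ} (hm : 0 < m)
    (hco : ∀ κ, D κ = 0 → m * ‖κ‖ ^ 2 ≤ Q κ κ) {C : ℝ} (hC0 : 0 ≤ C) (hC : ∀ k, Q (S k) (S k) ≤ C * ‖k‖ ^ 2)
    (y : F × (D.ker →L[ℝ] ℝ)) :
    ‖T.symm y‖ ≤ (‖S‖ + Real.sqrt (C / m) + m⁻¹) * ‖y‖ := by
  have h := norm_symm_le_of_testSection_columns T hT S hS hsymm hQ0 hm hco hC0 hC y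
  have h1 : ‖y.1‖ ≤ ‖y‖ := norm_fst_le y
  have h2 : ‖y.2‖ ≤ ‖y‖ := norm_snd_le y
  have hA : 0 ≤ ‖S‖ + Real.sqrt (C / m) := by positivity
  have hB : 0 ≤ m⁻¹ := (inv_pos.mpr hm).le
  calc ‖T.symm y‖ ≤ (‖S‖ + Real.sqrt (C / m)) * ‖y.1‖ + m⁻¹ * ‖y.2‖ := h
    _ ≤ (‖S‖ + Real.sqrt (C / m)) * ‖y‖ + m⁻¹ * ‖y‖ :=
        add_le_add (mul_le_mul_of_nonneg_left h1 hA) (mul_le_mul_of_nonneg_left h2 hB)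
    _ = (‖S‖ + Real.sqrt (C / m) + m⁻¹) * ‖y‖ := by ring

/-! ## §3. The END in `…HardStepChartRadius`'s binder shape -/

/-- **THE AUGMENTED-HESSIAN EQUIVALENCE WITH THE TEST-SECTION CONSTANT.**  Real Hilbert `E`, real normed `F`, `Q` symmetric and
`≥ 0`, `m`-coercive on `ker D` (`0 < m`), a section `S` with energy `Q(Sk)(Sk) ≤ C‖k‖²` (`0 ≤ C`) ⟹ `∃ T : E ≃L F × (ker D →L ℝ)`,
`T h = (D h, (Q h).comp (ker D).subtypeL)` and `‖T⁻¹ y‖ ≤ (‖S‖ + √(C∕m) + m⁻¹)‖y‖` — AHE §3 for existence (with `M := S`), §2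
for the bound. [folklore] -/
theorem exists_augHessian_equiv_of_testSection [CompleteSpace E] (S : F →L[ℝ] E) (hS : ∀ k, D (S k) = k)
    (hsymm : ∀ u v, Q u v = Q v u) (hQ0 : ∀ v, 0 ≤ Q v v) {m : ℝ} (hm : 0 < m)
    (hco : ∀ κ, D κ = 0 → m * ‖κ‖ ^ 2 ≤ Q κ κ) {C : ℝ} (hC0 : 0 ≤ C) (hC : ∀ k, Q (S k) (S k) ≤ C * ‖k‖ ^ 2) :
    ∃ T : E ≃L[ℝ] F × (D.ker →L[ℝ] ℝ),
      (∀ h, T h = (D h, (Q h).comp D.ker.subtypeL)) ∧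
      ∀ y, ‖T.symm y‖ ≤ (‖S‖ + Real.sqrt (C / m) + m⁻¹) * ‖y‖ := by
  obtain ⟨T, hT, -⟩ := AugmentedHessianEquivalence.exists_augHessian_equiv (Q := Q) hS hm hco
  exact ⟨T, hT, norm_symm_le_of_testSection T hT S hS hsymm hQ0 hm hco hC0 hC⟩

/-- **THE SAME IN `ℝ≥0` CURRENCY** — `…HardStepChartRadius.exists_criticalBranch_chart_ker`'s binders `T`, `hT`, `hN` VERBATIM at
`V'' δ₀ := Q`, for ANY `N : ℝ≥0` with `‖S‖ + √(C∕m) + m⁻¹ ≤ N`; `…HardStepInductiveStep.inductiveStep` runs on it with this `hN` in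
place of AHE's `(1 + ‖V″δ₀‖∕m)‖M‖ + m⁻¹ ≤ N`. [folklore] -/
theorem exists_augHessian_equiv_of_testSection_nnreal [CompleteSpace E] (S : F →L[ℝ] E) (hS : ∀ k, D (S k) = k)
    (hsymm : ∀ u v, Q u v = Q v u) (hQ0 : ∀ v, 0 ≤ Q v v) {m : ℝ} (hm : 0 < m)
    (hco : ∀ κ, D κ = 0 → m * ‖κ‖ ^ 2 ≤ Q κ κ) {C : ℝ} (hC0 : 0 ≤ C) (hC : ∀ k, Q (S k) (S k) ≤ C * ‖k‖ ^ 2)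
    {N : ℝ≥0} (hN : ‖S‖ + Real.sqrt (C / m) + m⁻¹ ≤ (N : ℝ)) :
    ∃ T : E ≃L[ℝ] F × (D.ker →L[ℝ] ℝ),
      (∀ h, T h = (D h, (Q h).comp D.ker.subtypeL)) ∧ ∀ y : F × (D.ker →L[ℝ] ℝ), ‖T.symm y‖ ≤ N * ‖y‖ := by
  obtain ⟨T, hT, hTN⟩ := exists_augHessian_equiv_of_testSection S hS hsymm hQ0 hm hco hC0 hC
  exact ⟨T, hT, fun y => (hTN y).trans (mul_le_mul_of_nonneg_right hN (norm_nonneg y))⟩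

/-! ## §3b. From a sandwich (the energy currency): `N = s + s√(γ₁∕γ₀) + γ₀⁻¹`; `1 + √(γ₁∕γ₀) + γ₀⁻¹` for an isometric section -/

/-- Real arithmetic: `√(γ₁s²∕γ₀) = s·√(γ₁∕γ₀)` for `0 ≤ s`. [folklore] -/
theorem sqrt_mul_sq_div {γ₀ γ₁ s : ℝ} (hs : 0 ≤ s) : Real.sqrt (γ₁ * s ^ 2 / γ₀) = s * Real.sqrt (γ₁ / γ₀) := by
  rw [show γ₁ * s ^ 2 / γ₀ = s ^ 2 * (γ₁ / γ₀) by ring, Real.sqrt_mul (sq_nonneg s), Real.sqrt_sq hs]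

/-- **THE CHART CONSTANT FROM A SANDWICH.**  `Q` symmetric with `γ₀‖v‖² ≤ Q v v ≤ γ₁‖v‖²` on `E` (`0 < γ₀`, `0 ≤ γ₁` — in the reference
form's ENERGY currency this is the sandwich `γ₀·P ≤ Q ≤ γ₁·P`), `S` ANY section of `D` with `‖S‖ ≤ s` ⟹ the test section `S` has energy
`≤ γ₁s²‖k‖²`, the kernel floor is `γ₀`, and §3 gives `∃ T` reading `(D, Q)` with `‖T⁻¹ y‖ ≤ (s + s√(γ₁∕γ₀) + γ₀⁻¹)‖y‖` — the condition
number under a square root (AHE's crude constant in the same letters: `(1 + γ₁∕γ₀)s + γ₀⁻¹`). [folklore] -/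
theorem exists_augHessian_equiv_of_sandwich [CompleteSpace E] (S : F →L[ℝ] E) (hS : ∀ k, D (S k) = k)
    (hsymm : ∀ u v, Q u v = Q v u) {γ₀ γ₁ : ℝ} (hγ₀ : 0 < γ₀) (hγ₁ : 0 ≤ γ₁) (hlo : ∀ v, γ₀ * ‖v‖ ^ 2 ≤ Q v v)
    (hhi : ∀ v, Q v v ≤ γ₁ * ‖v‖ ^ 2) {s : ℝ} (hs0 : 0 ≤ s) (hs : ‖S‖ ≤ s) :
    ∃ T : E ≃L[ℝ] F × (D.ker →L[ℝ] ℝ),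
      (∀ h, T h = (D h, (Q h).comp D.ker.subtypeL)) ∧
      ∀ y, ‖T.symm y‖ ≤ (s + s * Real.sqrt (γ₁ / γ₀) + γ₀⁻¹) * ‖y‖ := by
  have hQ0 : ∀ v, 0 ≤ Q v v := fun v => (mul_nonneg hγ₀.le (by positivity)).trans (hlo v)
  have hco : ∀ κ, D κ = 0 → γ₀ * ‖κ‖ ^ 2 ≤ Q κ κ := fun κ _ => hlo κ
  have hC : ∀ k, Q (S k) (S k) ≤ γ₁ * s ^ 2 * ‖k‖ ^ 2 := fun k => by
    have h1 : ‖S k‖ ≤ s * ‖k‖ := (S.le_opNorm k).trans (mul_le_mul_of_nonneg_right hs (norm_nonneg k))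
    have h2 : ‖S k‖ ^ 2 ≤ (s * ‖k‖) ^ 2 := pow_le_pow_left₀ (norm_nonneg _) h1 2
    calc Q (S k) (S k) ≤ γ₁ * ‖S k‖ ^ 2 := hhi _
      _ ≤ γ₁ * (s * ‖k‖) ^ 2 := mul_le_mul_of_nonneg_left h2 hγ₁
      _ = γ₁ * s ^ 2 * ‖k‖ ^ 2 := by ring
  obtain ⟨T, hT, hb⟩ := exists_augHessian_equiv_of_testSection S hS hsymm hQ0 hγ₀ hco (by positivity) hC
  refine ⟨T, hT, fun y => (hb y).trans (mul_le_mul_of_nonneg_right ?_ (norm_nonneg y))⟩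
  rw [sqrt_mul_sq_div hs0]
  linarith

/-- **THE ENERGY CURRENCY**: with an ISOMETRIC section (`‖Sk‖ = ‖k‖` — `F` carries the quotient ∕ energy norm of `D`) the constant is
`1 + √(γ₁∕γ₀) + γ₀⁻¹`: the sandwich constants and nothing else — for a composite blocking read in its own quotient norm this is the
ONE-SHOT chart letter, uniform in the number of steps (the pricing desk's (d2), letter level). [folklore] -/
theorem exists_augHessian_equiv_energyCurrency [CompleteSpace E] (S : F →L[ℝ] E) (hS : ∀ k, D (S k) = k)
    (hSiso : ∀ k, ‖S k‖ = ‖k‖) (hsymm : ∀ u v, Q u v = Q v u) {γ₀ γ₁ : ℝ} (hγ₀ : 0 < γ₀) (hγ₁ : 0 ≤ γ₁)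
    (hlo : ∀ v, γ₀ * ‖v‖ ^ 2 ≤ Q v v) (hhi : ∀ v, Q v v ≤ γ₁ * ‖v‖ ^ 2) :
    ∃ T : E ≃L[ℝ] F × (D.ker →L[ℝ] ℝ),
      (∀ h, T h = (D h, (Q h).comp D.ker.subtypeL)) ∧
      ∀ y, ‖T.symm y‖ ≤ (1 + Real.sqrt (γ₁ / γ₀) + γ₀⁻¹) * ‖y‖ := by
  have hs : ‖S‖ ≤ 1 := ContinuousLinearMap.opNorm_le_bound _ zero_le_one fun k => by rw [hSiso, one_mul]
  obtain ⟨T, hT, hb⟩ := exists_augHessian_equiv_of_sandwich S hS hsymm hγ₀ hγ₁ hlo hhi zero_le_one hs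
  exact ⟨T, hT, fun y => by simpa using hb y⟩

/-! ## §4. Nothing is lost: the crude section recovers a constant never worse than AHE's -/

omit [InnerProductSpace ℝ E] in
/-- THE CRUDE ENERGY LETTER OF ANY SECTION: `Q(Mk)(Mk) ≤ ‖Q‖‖M‖²‖k‖²`. [folklore] -/
theorem energy_le_of_rightInverse [NormedSpace ℝ E] (Q : E →L[ℝ] E →L[ℝ] ℝ) (M : F →L[ℝ] E) (k : F) :
    Q (M k) (M k) ≤ ‖Q‖ * ‖M‖ ^ 2 * ‖k‖ ^ 2 := by
  have h1 : Q (M k) (M k) ≤ ‖Q‖ * ‖M k‖ * ‖M k‖ := (le_abs_self _).trans (by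
    rw [← Real.norm_eq_abs]; exact Q.le_opNorm₂ (M k) (M k))
  have h2 : ‖M k‖ ≤ ‖M‖ * ‖k‖ := M.le_opNorm k
  have h3 : 0 ≤ ‖M k‖ := norm_nonneg _
  have h4 : 0 ≤ ‖Q‖ := norm_nonneg Q
  calc Q (M k) (M k) ≤ ‖Q‖ * ‖M k‖ * ‖M k‖ := h1
    _ ≤ ‖Q‖ * (‖M‖ * ‖k‖) * (‖M‖ * ‖k‖) := by gcongr
    _ = ‖Q‖ * ‖M‖ ^ 2 * ‖k‖ ^ 2 := by ring

omit [InnerProductSpace ℝ E] in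
/-- THE COERCIVITY NEVER EXCEEDS THE SIZE: if `ker D` has a nonzero vector, `m ≤ ‖Q‖`. [folklore] -/
theorem coercivity_le_opNorm [NormedSpace ℝ E] {Q : E →L[ℝ] E →L[ℝ] ℝ} {D : E →L[ℝ] F} {m : ℝ}
    (hco : ∀ κ, D κ = 0 → m * ‖κ‖ ^ 2 ≤ Q κ κ) {κ : E} (hκ : D κ = 0) (hκ0 : κ ≠ 0) : m ≤ ‖Q‖ := by
  have h1 := hco κ hκ
  have h2 : Q κ κ ≤ ‖Q‖ * ‖κ‖ * ‖κ‖ := (le_abs_self _).trans (by rw [← Real.norm_eq_abs]; exact Q.le_opNorm₂ κ κ)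
  have hpos : 0 < ‖κ‖ ^ 2 := by positivity
  nlinarith

/-- Real arithmetic: for `0 < m ≤ q` and `0 ≤ a`, `a + √(q·a²∕m) ≤ (1 + q∕m)·a` (since `√x ≤ x` for `1 ≤ x`). [folklore] -/
theorem add_sqrt_le_of_le {m q a : ℝ} (hm : 0 < m) (hq : m ≤ q) (ha : 0 ≤ a) :
    a + Real.sqrt (q * a ^ 2 / m) ≤ (1 + q / m) * a := by
  have hx : 1 ≤ q / m := by rwa [le_div_iff₀ hm, one_mul]
  have hsq : Real.sqrt (q / m) ≤ q / m := by
    rw [Real.sqrt_le_left (by linarith)]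
    nlinarith
  have e : Real.sqrt (q * a ^ 2 / m) = Real.sqrt (q / m) * a := by
    rw [show q * a ^ 2 / m = (q / m) * a ^ 2 by ring, Real.sqrt_mul (by positivity), Real.sqrt_sq ha]
  rw [e]
  nlinarith

/-- **NOTHING IS LOST**: with the crude test section `S := M` and the crude energy `C := ‖Q‖‖M‖²`, the test-section constant is
never worse than AHE's as soon as `m ≤ ‖Q‖` (`coercivity_le_opNorm`: always, off the trivial kernel):
`‖M‖ + √(‖Q‖‖M‖²∕m) + m⁻¹ ≤ (1 + ‖Q‖∕m)‖M‖ + m⁻¹`. [folklore] -/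
theorem testSection_const_le_AHE_const {m : ℝ} (hm : 0 < m) (Q : E →L[ℝ] E →L[ℝ] ℝ) (M : F →L[ℝ] E) (hq : m ≤ ‖Q‖) :
    ‖M‖ + Real.sqrt (‖Q‖ * ‖M‖ ^ 2 / m) + m⁻¹ ≤ (1 + ‖Q‖ / m) * ‖M‖ + m⁻¹ := by
  have h := add_sqrt_le_of_le hm hq (norm_nonneg M)
  linarith

/-! ## §5. Toy -/

/-- Toy (`E = F = ℝ`, `D = S = id`, `Q x y = x·y`, so `ker D = 0` and every kernel letter is vacuous; `C = ‖Q‖·1²`): §4's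
comparison at `m = ‖Q‖` reads `1 + √(‖Q‖∕‖Q‖) + ‖Q‖⁻¹ ≤ (1 + ‖Q‖∕‖Q‖)·1 + ‖Q‖⁻¹` whenever `0 < ‖Q‖`. -/
example (hQ : 0 < ‖ContinuousLinearMap.mul ℝ ℝ‖) :
    ‖ContinuousLinearMap.id ℝ ℝ‖ + Real.sqrt (‖ContinuousLinearMap.mul ℝ ℝ‖ * ‖ContinuousLinearMap.id ℝ ℝ‖ ^ 2 /
        ‖ContinuousLinearMap.mul ℝ ℝ‖) + ‖ContinuousLinearMap.mul ℝ ℝ‖⁻¹ ≤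
      (1 + ‖ContinuousLinearMap.mul ℝ ℝ‖ / ‖ContinuousLinearMap.mul ℝ ℝ‖) * ‖ContinuousLinearMap.id ℝ ℝ‖ +
        ‖ContinuousLinearMap.mul ℝ ℝ‖⁻¹ :=
  testSection_const_le_AHE_const (E := ℝ) (F := ℝ) hQ (ContinuousLinearMap.mul ℝ ℝ) (ContinuousLinearMap.id ℝ ℝ) le_rfl

end Summit.QuantumFields.BalabanUV.T4Continuum.NE7b.ChartLetterTestSection

end
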